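import Literature.NumberTheory.LocalFields.UnramifiedQuadraticFixedSquares              -- ★ FILE α: `odd_log_valued_of_not_isSquare`
import Literature.NumberTheory.Rogawski1990.LocalStableClassesNonsplitTypeTwoNorms      -- ★ B-p14: `exists_kappa_sq_eq_toLocalRing`
import Literature.NumberTheory.Rogawski1990.FinExplicitTransferFactorInertExponent      -- ★ ED. 2: `valued_two_eq_one_of_isUnit`, `exists_irredExponents` (consumer)
import Literature.NumberTheory.Automorphic.LocalUnitaryGroupCongr                       -- ★ `local_eq_unitaryGroupOfForm_map`
import Literature.NumberTheory.Automorphic.QuadraticHeckeCharacterCM                    -- ★ `cmQuadraticGenerator_spec` (a `δ` with `c δ = −δ ≠ 0`)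
import HarnessLib

/-!
# The discriminant of the irreducible unitary `2 × 2` block has ODD order at an inert place (`disc χ_g = 4ι(k)∕β₀²`, `ι(k)` a `σ_w`-fixed non-square)
# (Rogawski 1990, §3.6 p. 31; Flicker 1998, §6 Thm. 18 p. 97)

Topic `NumberTheory/Rogawski1990`; namespace `Literature.NumberTheory.Rogawski1990`.  THEOREMS ONLY (no definition, no instance, no notation, no named fact, no `sorry`;
count-neutral).  Cell `pub/hodgecm-mathlib`, F0∕P3a road «D-N7-inert», line «N7nsCount» (`stub_countIrredClause`): the HYPOTHESIS `hN : v_w(disc χ_{g,w}) = exp(−(2N+1))`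
of the type-(2) exponent stub ★ `exists_irredExponents` DISCHARGED from `hirr` + unitarity (B-p14 (g30) 2026-09-01T04:42:03Z route, architect A-p06 (g26)).  HONEST
LABEL: HC_CM is proved only modulo the printed citations until rung 0 closes.

THE MATHEMATICS.  `γ_H = (g, u) ∈ H_v` at a non-split place `v` UNRAMIFIED in the CM field `L` with ODD residue characteristic, `χ_{g,w}` WITHOUT a root in `L_w = E_v`.
★ B-p14 `exists_kappa_sq_eq_toLocalRing`: `E_v[g]` contains `κ = α₀ + β₀ g` (`β₀ ≠ 0`) with `κ² = ι_v(k)`, `k ∈ F_v`, and `ι_v(k)` is NOT A SQUARE in the field `E_v` (★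
`not_isSquare_of_kappa`: `(κ − s)(κ + s) = 0` in the domain `E_v[g]` would make `κ` scalar).  Cayley–Hamilton on `κ² = k` gives `tr g = −2α₀∕β₀`, `det g = (α₀² − k)∕β₀²`
(★ `trace_eq_zero_and_det_eq_of_sq`), so **`β₀² · disc χ_g = β₀²(tr² g − 4 det g) = 4 ι_v(k)`** (§1).  At `w`: `ι_w(k)` is `σ_w`-FIXED and a NON-SQUARE in `L_w`, hence of
ODD order (★ FILE α `odd_log_valued_of_not_isSquare`: `σ_w`-fixed elements of even order are squares at an inert place with `p` odd); `β₀²` and `4` have even∕zero order, so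
`ord_w disc χ_{g,w}` is ODD, and for integral `tr g_w, det g_w` it is `2N + 1`, `N : ℕ` (**`exists_valued_disc_eq_exp_neg_odd_of_not_exists_isRoot`**).

## References
* [Rogawski1990] J. D. Rogawski, *Automorphic Representations of Unitary Groups in Three Variables*, Ann. of Math. Stud. 123 (1990), §3.6 p. 31 (the tori `T ≃ (EK)¹`, `K ≠ E` ramified).
* [Flicker1998UnitaryFL] Y. Z. Flicker, *Elementary proof of the fundamental lemma for a unitary group*, Canad. J. Math. 50 (1998), §6 Thm. 18 p. 97 (`EL∕E` ramified, `disc` of odd order).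
* [Serre1979] J.-P. Serre, *Local Fields*, GTM 67 (1979), Ch. XIV §4.
-/

set_option autoImplicit false

noncomputable section

open Matrix NumberField IsDedekindDomain Polynomial
open scoped MatrixGroups Valued

namespace Literature.NumberTheory.Rogawski1990

open Literature.AlgebraicGeometry.ShimuraVarieties Literature.NumberTheory.Automorphic Literature.NumberTheory.Automorphic.UnitaryGroup
open Literature.NumberTheory.GaloisRepresentations Literature.NumberTheory.LocalFields.UnramifiedQuadraticNorm

/-! ## §1 Over a field: `β₀² · (tr² A − 4 det A) = 4k` when `(α₀ + β₀A)² = k`, `A` non-scalar -/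

section Field

variable {K : Type*} [Field K]

/-- **`β₀² · disc χ_A = 4k`** for `κ = α₀ + β₀A` with `κ² = k`, `β₀ ≠ 0`… precisely for `A` NON-SCALAR: Cayley–Hamilton gives `tr κ = 0`, `det κ = −k` (★ `trace_eq_zero_and_det_eq_of_sq`),
i.e. `2α₀ + β₀ tr A = 0` and `α₀² + α₀β₀ tr A + β₀² det A = −k`, whence `β₀²(tr² A − 4 det A) = 4k` — the eigenvalues of `A` are `(±√k − α₀)∕β₀`.
[cite: Rogawski1990, §3.6 p. 31] -/
theorem sq_mul_trace_sq_sub_four_mul_det_eq_of_kappa_sq {A : Matrix (Fin 2) (Fin 2) K} {α₀ β₀ k : K}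
    (hsq : (α₀ • (1 : Matrix (Fin 2) (Fin 2) K) + β₀ • A) * (α₀ • 1 + β₀ • A) = k • (1 : Matrix (Fin 2) (Fin 2) K)) (hβ₀ : β₀ ≠ 0)
    (hA : ∀ c : K, A ≠ c • 1) : β₀ ^ 2 * (A.trace ^ 2 - 4 * A.det) = 4 * k := by
  obtain ⟨htr, hdet⟩ := trace_eq_zero_and_det_eq_of_sq hsq (kappa_ne_smul_one rfl hβ₀ hA)
  rw [trace_smul_one_add_smul] at htr
  rw [det_smul_one_add_smul] at hdet
  linear_combination (β₀ * A.trace + 2 * α₀) * htr - 4 * hdet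

end Field

/-! ## §2 The CM carriers: `disc χ_{g,w}` has odd order for the irreducible unitary block -/

section CM

variable (L : Type) [Field L] [NumberField L] [IsCMField L] (v : HeightOneSpectrum (𝓞 ↥(maximalRealSubfield L)))
  (w : PlacesOver L v) (hw : IsCMField.complexConj L • w.1 = w.1)

omit [IsCMField L] in
/-- The local form of `Φ₂` over `E_v` is the literal `antidiag(1, 1)`. [cite: Rogawski1990, §3.5 p. 29] -/
private theorem antidiagTwo_map_algebraMap' :
    (Matrix.of fun i j : Fin 2 => if i.val + j.val + 1 = 2 then (1 : L) else 0).map (algebraMap L (LocalRing L v)) =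
      Matrix.of fun i j : Fin 2 => if i.val + j.val + 1 = 2 then (1 : LocalRing L v) else 0 := by
  ext i j
  simp only [map_apply, of_apply]
  split_ifs <;> simp

omit [IsCMField L] in
/-- An odd non-positive `log`-valuation is `−(2N+1)`, `N : ℕ` (bookkeeping). [folklore] -/
private theorem exists_valued_eq_exp_neg_odd_of_odd {x : w.1.adicCompletion L} (hx0 : x ≠ 0) (hodd : Odd (WithZero.log (Valued.v x)))
    (hle : Valued.v x ≤ 1) : ∃ N : ℕ, Valued.v x = WithZero.exp (-((2 * N + 1 : ℕ) : ℤ)) := by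
  have hv0 : Valued.v x ≠ 0 := (Valuation.ne_zero_iff _).2 hx0
  have hle' : WithZero.log (Valued.v x) ≤ 0 := by
    rw [WithZero.log_le_iff_le_exp hv0, WithZero.exp_zero]; exact hle
  obtain ⟨k, hk⟩ := hodd
  refine ⟨(-k - 1).toNat, ?_⟩
  rw [← WithZero.exp_log hv0]
  congr 1
  push_cast
  rw [Int.toNat_of_nonneg (by omega)]
  omega

include hw in
/-- **THE DISCRIMINANT OF THE IRREDUCIBLE UNITARY BLOCK HAS ODD ORDER.**  In the frame of `stub_countIrredClause`: `γ_H = (g, u) ∈ H_v` at a non-split `v` unramified in `L`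
(`w ∣ v`, `c • w = w`) with `IsUnit (2 : 𝒪_w)`, `χ_{g,w}` without a root in `L_w` (`hirr`), and `tr g_w`, `det g_w` integral: `v_w(tr² g_w − 4 det g_w) = exp(−(2N+1))`
for some `N : ℕ` — the hypothesis `hN` of ★ `exists_irredExponents` ∕ ★ `log_valued_eval_finCharpolyTwo_apply_eq_neg_min` (B-p14's `N`: `ord_{EL}(λ − λ′) = 2N + 1`; the
splitting field of `χ_g` is RAMIFIED over `L_w`). [cite: Rogawski1990, §3.6 p. 31] [cite: Flicker1998UnitaryFL, §6 Thm. 18 p. 97] [cite: Serre1979, Ch. XIV §4] -/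
theorem exists_valued_disc_eq_exp_neg_odd_of_not_exists_isRoot (hunr : Algebra.IsUnramifiedIn (𝓞 L) v.asIdeal)
    (h2 : IsUnit (2 : 𝒪[w.1.adicCompletion L]))
    {γH : (cmDatum L 2 (Matrix.of fun i j : Fin 2 => if i.val + j.val + 1 = 2 then (1 : L) else 0)).Local v ×
      (cmDatum L 1 (Matrix.of fun i j : Fin 1 => if i.val + j.val + 1 = 1 then (1 : L) else 0)).Local v}
    (hirr : ¬ ∃ x : w.1.adicCompletion L, (((γH.1.val : GL (Fin 2) (LocalRing L v)).val.map
        (Pi.evalRingHom (fun w' : PlacesOver L v => w'.1.adicCompletion L) w)).charpoly).IsRoot x)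
    (htr : Valued.v ((γH.1.val : GL (Fin 2) (LocalRing L v)).val.map
        (Pi.evalRingHom (fun w' : PlacesOver L v => w'.1.adicCompletion L) w)).trace ≤ 1)
    (hdet : Valued.v ((γH.1.val : GL (Fin 2) (LocalRing L v)).val.map
        (Pi.evalRingHom (fun w' : PlacesOver L v => w'.1.adicCompletion L) w)).det ≤ 1) :
    ∃ N : ℕ, Valued.v (((γH.1.val : GL (Fin 2) (LocalRing L v)).val.map
        (Pi.evalRingHom (fun w' : PlacesOver L v => w'.1.adicCompletion L) w)).trace ^ 2 -
        4 * ((γH.1.val : GL (Fin 2) (LocalRing L v)).val.map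
        (Pi.evalRingHom (fun w' : PlacesOver L v => w'.1.adicCompletion L) w)).det) =
      WithZero.exp (-((2 * N + 1 : ℕ) : ℤ)) := by
  have hc1 : IsCMField.complexConj L ≠ 1 := IsCMField.complexConj_ne_one L
  haveI : Subsingleton (PlacesOver L v) := PlacesOver.subsingleton_of_smul_eq (IsCMField.complexConj L) hc1 w hw
  letI : Field (LocalRing L v) := (LocalRing.isField_of_smul_eq (IsCMField.complexConj L) hc1 w hw).toField
  set ev := Pi.evalRingHom (fun w' : PlacesOver L v => w'.1.adicCompletion L) w with hev
  set A : Matrix (Fin 2) (Fin 2) (LocalRing L v) := (γH.1.val : GL (Fin 2) (LocalRing L v)).val with hAdef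
  -- `χ_A` has no root in `E_v` (a root `r` would give the root `r_w` of `χ_{g,w}`)
  have hA : ∀ r : LocalRing L v, A.charpoly.eval r ≠ 0 := by
    intro r hr
    refine hirr ⟨r w, ?_⟩
    rw [Matrix.charpoly_map, Polynomial.IsRoot.def, Polynomial.eval_map]
    have h := Polynomial.eval₂_at_apply (p := A.charpoly) ev r
    rw [hr, map_zero] at h
    exact h
  -- the form `Φ₂` over `E_v`: hermitian, unit determinant, and `g` is unitary for it
  have hΦh : ((Matrix.of fun i j : Fin 2 => if i.val + j.val + 1 = 2 then (1 : LocalRing L v) else 0).map (conjLocal L (IsCMField.complexConj L) v))ᵀ =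
      Matrix.of fun i j : Fin 2 => if i.val + j.val + 1 = 2 then (1 : LocalRing L v) else 0 := by
    ext i j
    fin_cases i <;> fin_cases j <;> simp [Matrix.of_apply]
  have hΦd : IsUnit (Matrix.of fun i j : Fin 2 => if i.val + j.val + 1 = 2 then (1 : LocalRing L v) else 0).det := by
    rw [Matrix.det_fin_two]
    simp [Matrix.of_apply]
  have hAu : (A.map (conjLocal L (IsCMField.complexConj L) v))ᵀ * (Matrix.of fun i j : Fin 2 => if i.val + j.val + 1 = 2 then (1 : LocalRing L v) else 0) * A =
      Matrix.of fun i j : Fin 2 => if i.val + j.val + 1 = 2 then (1 : LocalRing L v) else 0 := by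
    have h : (γH.1.val : GL (Fin 2) (LocalRing L v)) ∈ unitaryGroupOfForm (conjLocal L (IsCMField.complexConj L) v)
        ((Matrix.of fun i j : Fin 2 => if i.val + j.val + 1 = 2 then (1 : L) else 0).map (algebraMap L (LocalRing L v))) := by
      rw [← local_eq_unitaryGroupOfForm_map]
      exact γH.1.property
    rw [antidiagTwo_map_algebraMap'] at h
    exact h
  -- B-p14's `κ = α₀ + β₀ g`, `κ² = ι_v(k)`, `ι_v(k)` not a square in `E_v`
  obtain ⟨δ, hδ0, hcδ, -⟩ := cmQuadraticGenerator_spec L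
  obtain ⟨α₀, β₀, k, hβ₀, -, hsq, -⟩ :=
    exists_kappa_sq_eq_toLocalRing L v (IsCMField.complexConj L) hcδ hδ0 w hw hΦh hΦd hAu hA
  have hkE : ¬ IsSquare (toLocalRing L v k) := not_isSquare_of_kappa hA rfl hβ₀ hsq
  -- `β₀² · disc χ_A = 4 ι_v(k)` in `E_v`, read at `w`
  have hdisc : β₀ ^ 2 * (A.trace ^ 2 - 4 * A.det) = 4 * toLocalRing L v k :=
    sq_mul_trace_sq_sub_four_mul_det_eq_of_kappa_sq hsq hβ₀ (ne_smul_one_of_eval_charpoly_ne_zero hA)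
  have hdiscw : (β₀ w) ^ 2 * ((A.map ev).trace ^ 2 - 4 * (A.map ev).det) = 4 * UnitaryGroup.toPlace v w k := by
    have h := congrArg ev hdisc
    rw [map_mul, map_pow, map_sub, map_mul, map_pow, map_mul, AddMonoidHom.map_trace ev A, RingHom.map_det ev A] at h
    simpa [hev] using h
  -- `ι_w(k)` is a `σ_w`-fixed non-square in `L_w`, hence of odd order
  set z : w.1.adicCompletion L := UnitaryGroup.toPlace v w k with hz
  have hσz : galAdicCompletionMap (L := L) (IsCMField.complexConj L) hw z = z := UnitaryGroup.galAdicCompletionMap_toPlace_self L v w hw k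
  have hzns : ¬ IsSquare z := by
    rintro ⟨s, hs⟩
    letI : Unique (PlacesOver L v) := uniqueOfSubsingleton w
    let π : LocalRing L v ≃+* w.1.adicCompletion L := RingEquiv.piUnique fun w' : PlacesOver L v => w'.1.adicCompletion L
    apply hkE
    refine ⟨π.symm s, (LocalRing.eq_iff_apply_eq (IsCMField.complexConj L) hc1 w hw _ _).2 ?_⟩
    rw [toLocalRing_apply, Pi.mul_apply]
    change z = π (π.symm s) * π (π.symm s)
    rw [π.apply_symm_apply]
    exact hs
  have h2' : Valued.v (2 : w.1.adicCompletion L) = 1 := valued_two_eq_one_of_isUnit L v w h2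
  have hzodd : Odd (WithZero.log (Valued.v z)) := odd_log_valued_of_not_isSquare L v w hw hunr h2' hσz hzns
  have hz0 : z ≠ 0 := fun h0 => hzns ⟨0, by rw [h0, mul_zero]⟩
  have hβw : β₀ w ≠ 0 := fun h0 => hβ₀ ((LocalRing.eq_iff_apply_eq (IsCMField.complexConj L) hc1 w hw β₀ 0).2 (by rw [h0]; rfl))
  -- parity bookkeeping: `2 log v(β₀ w) + log v(disc) = log v 4 + log v z = log v z`
  set D := (A.map ev).trace ^ 2 - 4 * (A.map ev).det with hD
  have h4 : Valued.v (4 : w.1.adicCompletion L) = 1 := by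
    rw [show (4 : w.1.adicCompletion L) = 2 * 2 by norm_num, map_mul, h2', one_mul]
  have h40 : (4 : w.1.adicCompletion L) ≠ 0 := fun h => by rw [h, map_zero] at h4; exact zero_ne_one h4
  have hD0 : D ≠ 0 := by
    intro h0
    rw [h0, mul_zero] at hdiscw
    exact mul_ne_zero h40 hz0 hdiscw.symm
  have hvβ : Valued.v (β₀ w) ≠ 0 := (Valuation.ne_zero_iff _).2 hβw
  have hvD : Valued.v D ≠ 0 := (Valuation.ne_zero_iff _).2 hD0
  have hlog : WithZero.log (Valued.v (β₀ w)) + WithZero.log (Valued.v (β₀ w)) + WithZero.log (Valued.v D) = WithZero.log (Valued.v z) := by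
    have h : WithZero.log (Valued.v (β₀ w ^ 2 * D)) = WithZero.log (Valued.v (4 * z)) := by rw [hdiscw]
    rw [map_mul, map_mul, map_pow, h4, one_mul, pow_two, WithZero.log_mul (mul_ne_zero hvβ hvβ) hvD, WithZero.log_mul hvβ hvβ] at h
    exact h
  have hDodd : Odd (WithZero.log (Valued.v D)) := by
    obtain ⟨m, hm⟩ := hzodd
    exact ⟨m - WithZero.log (Valued.v (β₀ w)), by linarith⟩
  -- integrality of `D`
  have hDle : Valued.v D ≤ 1 := by
    refine (Valuation.map_sub _ _ _).trans (max_le ?_ ?_)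
    · rw [map_pow]; exact pow_le_one₀ zero_le htr
    · rw [map_mul, h4, one_mul]; exact hdet
  exact exists_valued_eq_exp_neg_odd_of_odd L v w hD0 hDodd hDle

end CM

end Literature.NumberTheory.Rogawski1990

end
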